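import Summits.CriticalPhenomena.SAWScalingLimit.Theses.SAWTotalPositivity
import Literature.Probability.LatticeModels.WeakBeurlingEstimate

/-!
# Ring sites of a sup-norm lattice box see at most one site of the open box

Support lemma (negative lane, drefute gen 2) for the line `radial-portal-transfer` of crux
`TPToTraversalBound` (stmt-CriticalPhenomena-10687): a lattice site `v` outside the open sup-norm box
`{w | max |w 0 - c 0| |w 1 - c 1| < N}` has at most one `ℤ²`-neighbour inside that box.  Consequences used
by the line (stated in `Lines/radial-portal-transfer.lean`, argued in `DrefuteSurvivedRadialPortalTransferG2.md`
and in `Disproof.lean` §10): inside an atom `{outEdgeSet γ = outEdgeSet γ₀}` every outside vertex other than the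
two walk endpoints carries an out-edge, the maximal outside pieces with at least two vertices are exactly the
connected components of the out-edge graph (so the heaviness count `h_l` is measurable with respect to the
outside configuration — the filtration of `stub_chain`), and the outside paths are rigid within an atom.
The coordinate form of `ℤ²`-adjacency is reused from `WeakBeurling.coord_step_of_adj`.
-/

namespace Summit.CriticalPhenomena.SAWScalingLimit.Theorems.TPToTraversalBound.Negative

open Literature.Probability.LatticeModels Literature.Probability.LatticeModels.WeakBeurling

/-- **A ring site sees at most one site of the open box.**  If `v` lies outside the open sup-norm box of
half-side `N` about `c` (`N ≤ max |v 0 - c 0| |v 1 - c 1|`) then any two `ℤ²`-neighbours of `v` inside that open box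
coincide.  (At a corner of the ring there is none; elsewhere on the ring `max = N` there is exactly the inward
neighbour.)  Hence no self-avoiding walk can visit an outside vertex between two inside vertices: outside visits
other than at the walk's endpoints use an edge with both ends outside. [folklore] -/
theorem eq_of_adj_of_inOpenBox (c v w w' : Site 2) (N : ℕ)
    (hv : (N : ℤ) ≤ max |v 0 - c 0| |v 1 - c 1|)
    (hw : max |w 0 - c 0| |w 1 - c 1| < N) (hw' : max |w' 0 - c 0| |w' 1 - c 1| < N)
    (h1 : (zdGraph 2).Adj v w) (h2 : (zdGraph 2).Adj v w') : w = w' := by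
  rw [max_lt_iff, abs_lt, abs_lt] at hw hw'
  rw [le_max_iff, le_abs, le_abs] at hv
  have e1 := coord_step_of_adj h1
  have e2 := coord_step_of_adj h2
  have key : w 0 = w' 0 ∧ w 1 = w' 1 := by omega
  funext i
  fin_cases i
  · exact key.1
  · exact key.2

/-- Corner form: if BOTH coordinates of `v - c` have absolute value at least `N`, then `v` has no neighbour in
the open box at all (the four ring corners carry no portal). [folklore] -/
theorem not_inOpenBox_of_adj_corner (c v w : Site 2) (N : ℕ)
    (hv0 : (N : ℤ) ≤ |v 0 - c 0|) (hv1 : (N : ℤ) ≤ |v 1 - c 1|)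
    (h : (zdGraph 2).Adj v w) : ¬ max |w 0 - c 0| |w 1 - c 1| < N := by
  intro hw
  rw [max_lt_iff, abs_lt, abs_lt] at hw
  rw [le_abs] at hv0 hv1
  have e := coord_step_of_adj h
  omega

end Summit.CriticalPhenomena.SAWScalingLimit.Theorems.TPToTraversalBound.Negative
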